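import Literature.Analysis.FluidPDE.PineauVicolRSS
import Literature.Analysis.FluidPDE.PineauVicolRSSChaeWolf
import Literature.Analysis.FluidPDE.TypeIAncientMild
import Literature.Analysis.FluidPDE.KNSSMildDecayProofs
import Literature.Analysis.FluidPDE.MildSolution
import Literature.Analysis.FluidPDE.SelfSimilar
import HarnessLib

/-!
# Route TypeICertificateLadder — crux `Target` (item stmt-NavierStokesRegularity-1217),
# line `killing-twisted-bernoulli-solitons`: embedding of Pineau–Vicol's RSS class into the
# Oseen-gauge rate class (sub-goal SB1, stub `solitonBridge_isTypeIAncientMild`)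

Helper file (theorems only). Let `(u, p)` be a classical solution of the unforced Navier–Stokes
system (`ν = 1`) on the time set `[−1, 0)` with the apex Type-I bound
`‖u(t, x)‖ ≤ C₀ / (‖x‖ + √(−t))` there, and assume `u` is Pineau–Vicol's rotated self-similar
ansatz `u = pvAnsatz α (fun y _ => U y)` on `[−1, 0)` (arXiv:2607.09619, (1.7)). Then the ansatz
field `v := pvAnsatz α (fun y _ => U y)` (defined for all `t < 0`) is

* a classical solution on `(−∞, 0)` for some pressure (Pineau–Vicol, §2 footnote 13; tree:
  `exists_isClassicalNSSolutionOn_Iio_of_rss`, through Remark 1.5, RSS ⊆ DSS with factor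
  `e^{π/|α|}` — `isDiscretelySelfSimilar_pvAnsatz`, `rotZ_add_eq_self_of_exp_pi_div_abs`; for
  `α = 0` any factor, e.g. `2`, works);
* Type-I with the same constant on all of `t < 0` (Remark 1.2: the profile bound
  `‖U(y)‖ ≤ C₀/(‖y‖ + 1)` read off at `t = −1`, `profile_bound_of_typeI`, propagates to every
  `t < 0`, `norm_pvAnsatz_le_of_profile`);
* in the rate class `IsTypeIAncientMild C₀ v`: jointly smooth and divergence free (from the
  classical extension), Oseen-mild between every pair `s < t < 0` (KNSS 2009, Thm 6.1,
  mildness clause; tree: `KNSS2009_mild_of_rMulNorm_bounded_holds`, applied on the window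
  `(s − 1, 0)` with `T = t`, where the Type-I bound gives `‖v‖ ≤ C₀/√(−t)` and
  `|x'| ‖v(τ, x)‖ ≤ ‖x‖ ‖v(τ, x)‖ ≤ C₀`), with the temporal bound `‖v(t, x)‖ ≤ C₀/√(−t)`
  (`HasTypeIDecay.hasTypeITimeDecay`).

## References

* B. Pineau, V. Vicol, arXiv:2607.09619 (2026): (1.7), (1.10), Remarks 1.2, 1.3, 1.5, §2
  footnote 13. [PineauVicol2026]
* G. Koch, N. Nadirashvili, G. Seregin, V. Šverák, Acta Math. 203 (2009) = arXiv:0709.3599,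
  Thm 6.1 (mildness clause), §4 p. 8. [KochNadirashviliSereginSverak2009]
-/

noncomputable section

-- the summit and its single sub-problem share the name (CONVENTIONS §1), as in every Theorems file
set_option linter.dupNamespace false

namespace Summit.NavierStokesRegularity.NavierStokesRegularity.Theorems

open Set Function Filter MeasureTheory
open Literature.Analysis Literature.Analysis.FluidPDE

/-- The constant of a Type-I bound is nonnegative (evaluate at `t = −1`, `x = 0`). [folklore] -/
private theorem solitonBridge_typeI_const_nonneg {C₀ : ℝ}
    {v : ℝ → EuclideanSpace ℝ (Fin 3) → EuclideanSpace ℝ (Fin 3)} (hdec : HasTypeIDecay C₀ v) :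
    0 ≤ C₀ := by
  have h := hdec (-1) (by norm_num) 0
  rw [norm_zero, zero_add, neg_neg, Real.sqrt_one, div_one] at h
  exact (norm_nonneg _).trans h

/-- A Type-I field is bounded by `C₀ / √(−t)` on `(−∞, t] × ℝ³` for `t < 0`:
`‖v(τ, y)‖ ≤ C₀ / (‖y‖ + √(−τ)) ≤ C₀ / √(−t)` for `τ ≤ t`. [folklore] -/
private theorem solitonBridge_typeI_norm_le {C₀ : ℝ}
    {v : ℝ → EuclideanSpace ℝ (Fin 3) → EuclideanSpace ℝ (Fin 3)} (hdec : HasTypeIDecay C₀ v)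
    {t τ : ℝ} (ht : t < 0) (hτ : τ ≤ t) (y : EuclideanSpace ℝ (Fin 3)) :
    ‖v τ y‖ ≤ C₀ / Real.sqrt (-t) := by
  have hC := solitonBridge_typeI_const_nonneg hdec
  have hτ0 : τ < 0 := lt_of_le_of_lt hτ ht
  calc ‖v τ y‖ ≤ C₀ / (‖y‖ + Real.sqrt (-τ)) := hdec τ hτ0 y
    _ ≤ C₀ / Real.sqrt (-t) := by
        refine div_le_div_of_nonneg_left hC (Real.sqrt_pos.2 (by linarith)) ?_
        calc Real.sqrt (-t) ≤ Real.sqrt (-τ) := Real.sqrt_le_sqrt (by linarith)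
          _ ≤ ‖y‖ + Real.sqrt (-τ) := le_add_of_nonneg_left (norm_nonneg _)

/-- The horizontal decay (6.2) of KNSS 2009 for a Type-I field:
`|x'| ‖v(τ, y)‖ ≤ ‖y‖ ‖v(τ, y)‖ ≤ C₀` for `τ < 0`. [folklore] -/
private theorem solitonBridge_typeI_cylRadius_mul_norm_le {C₀ : ℝ}
    {v : ℝ → EuclideanSpace ℝ (Fin 3) → EuclideanSpace ℝ (Fin 3)} (hdec : HasTypeIDecay C₀ v)
    {τ : ℝ} (hτ : τ < 0) (y : EuclideanSpace ℝ (Fin 3)) : cylRadius y * ‖v τ y‖ ≤ C₀ := by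
  have hC := solitonBridge_typeI_const_nonneg hdec
  have hs : 0 < Real.sqrt (-τ) := Real.sqrt_pos.2 (by linarith)
  have hden : 0 < ‖y‖ + Real.sqrt (-τ) := by positivity
  calc cylRadius y * ‖v τ y‖ ≤ ‖y‖ * (C₀ / (‖y‖ + Real.sqrt (-τ))) :=
        mul_le_mul (SereginSverak2009.cylRadius_le_norm' y) (hdec τ hτ y) (norm_nonneg _)
          (norm_nonneg _)
    _ = C₀ * (‖y‖ / (‖y‖ + Real.sqrt (-τ))) := by ring
    _ ≤ C₀ * 1 := by
        refine mul_le_mul_of_nonneg_left ?_ hC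
        rw [div_le_one hden]
        linarith [hs.le]
    _ = C₀ := mul_one _

/-- **Mildness of Type-I classical solutions between every pair of negative times** (KNSS 2009,
Thm 6.1, mildness clause, through `KNSS2009_mild_of_rMulNorm_bounded_holds` on the window
`(s − 1, 0)` with `T = t`): for `s < t < 0`,
`v(t, x) = (e^{(t−s)Δ} v(s))(x) − B¹_s(v, v)(t)(x)`. [cite: KochNadirashviliSereginSverak2009, Thm 6.1 (mildness clause), proof last paragraph (arXiv:0709.3599 p. 12)] -/
private theorem solitonBridge_typeI_mild {C₀ : ℝ}
    {v : ℝ → EuclideanSpace ℝ (Fin 3) → EuclideanSpace ℝ (Fin 3)}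
    {q : ℝ → EuclideanSpace ℝ (Fin 3) → ℝ} (hv : IsClassicalNSSolutionOn (Iio 0) 1 0 v q)
    (hdec : HasTypeIDecay C₀ v) {s t : ℝ} (hst : s < t) (ht : t < 0)
    (x : EuclideanSpace ℝ (Fin 3)) :
    v t x = UnboundedOperators.heatExtension (v s) (t - s) x - oseenDuhamel 1 s v v t x := by
  have hcl : IsClassicalNSSolutionOn (Ioo (s - 1) 0) 1 0 v q :=
    hv.mono Ioo_subset_Iio_self (uniqueDiffOn_Ioo _ _)
  have hL : ∃ L : ℝ, ∀ τ ∈ Ioc (s - 1) t, ∀ y : EuclideanSpace ℝ (Fin 3), ‖v τ y‖ ≤ L :=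
    ⟨C₀ / Real.sqrt (-t), fun τ hτ y => solitonBridge_typeI_norm_le hdec ht hτ.2 y⟩
  have hD : ∃ D : ℝ, ∀ τ ∈ Ioc (s - 1) t, ∀ y : EuclideanSpace ℝ (Fin 3),
      cylRadius y * ‖v τ y‖ ≤ D :=
    ⟨C₀, fun τ hτ y => solitonBridge_typeI_cylRadius_mul_norm_le hdec (lt_of_le_of_lt hτ.2 ht) y⟩
  exact KNSS2009_mild_of_rMulNorm_bounded_holds hcl (by linarith) ht hL hD
    (s := s) (t := t) (by linarith) hst le_rfl x

/-- **A discrete self-similarity factor for the RSS ansatz** (Pineau–Vicol 2026, Remark 1.5,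
RSS ⊆ DSS): there is `c > 1` with `R(θ + α · 2 log c) = R(θ)` for all `θ` — for `α ≠ 0` take
`c = e^{π/|α|}` (`α · 2 log c = ±2π`), for `α = 0` any `c > 1`, e.g. `c = 2`. [cite: PineauVicol2026, Remark 1.5 (arXiv:2607.09619 p. 5)] -/
private theorem solitonBridge_exists_dss_factor (α : ℝ) :
    ∃ c : ℝ, 1 < c ∧ ∀ (θ : ℝ) (w : EuclideanSpace ℝ (Fin 3)),
      rotZ (θ + α * (2 * Real.log c)) w = rotZ θ w := by
  rcases eq_or_ne α 0 with rfl | hα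
  · exact ⟨2, by norm_num, fun θ w => by rw [zero_mul, add_zero]⟩
  · exact ⟨Real.exp (Real.pi / |α|), Real.one_lt_exp_iff.2 (div_pos Real.pi_pos (abs_pos.2 hα)),
      fun θ w => rotZ_add_eq_self_of_exp_pi_div_abs hα θ w⟩

/-- **SB1 — embedding of Pineau–Vicol's Type-I RSS class into the Oseen-gauge rate class.**
Let `(u, p)` be a classical solution of Navier–Stokes (`ν = 1`, `f = 0`) on the time set
`[−1, 0)` with the apex Type-I bound `‖u(t, x)‖ ≤ C₀ / (‖x‖ + √(−t))` (Pineau–Vicol (1.10)),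
and let `u` be the rotated self-similar ansatz `pvAnsatz α (fun y _ => U y)` there ((1.7)).
Then the ansatz field `v` (for all `t < 0`) lies in the rate class `IsTypeIAncientMild C₀ v`
(jointly smooth, divergence free, Oseen-mild between all `s < t < 0`, `‖v‖ ≤ C₀/√(−t)`),
keeps the apex bound `HasTypeIDecay C₀ v`, and is a classical solution on `(−∞, 0)` for some
pressure. Proof: `v` is `c`-DSS with `c = e^{π/|α|}` (Remark 1.5; `c = 2` if `α = 0`), hence
extends to a classical solution on `(−∞, 0)` (footnote 13,
`exists_isClassicalNSSolutionOn_Iio_of_rss`); the profile bound at `t = −1` gives the Type-I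
bound for all `t < 0` (Remark 1.2); mildness between all pairs of negative times is KNSS 2009,
Thm 6.1 (`KNSS2009_mild_of_rMulNorm_bounded_holds`). [cite: PineauVicol2026, Remarks 1.2, 1.5 and §2 footnote 13 (arXiv:2607.09619 pp. 4–6, 10)] -/
theorem solitonBridge_isTypeIAncientMild : ∀ (C₀ α : ℝ) (u : ℝ → EuclideanSpace ℝ (Fin 3) → EuclideanSpace ℝ (Fin 3)) (p : ℝ → EuclideanSpace ℝ (Fin 3) → ℝ) (U : EuclideanSpace ℝ (Fin 3) → EuclideanSpace ℝ (Fin 3)), Literature.Analysis.FluidPDE.IsClassicalNSSolutionOn (Set.Ico (-1) 0) 1 0 u p → (∀ t ∈ Set.Ico (-1 : ℝ) 0, ∀ x : EuclideanSpace ℝ (Fin 3), ‖u t x‖ ≤ C₀ / (‖x‖ + Real.sqrt (-t))) → (∀ t ∈ Set.Ico (-1 : ℝ) 0, ∀ x : EuclideanSpace ℝ (Fin 3), u t x = Literature.Analysis.FluidPDE.pvAnsatz α (fun y _ => U y) t x) → Literature.Analysis.FluidPDE.IsTypeIAncientMild C₀ (Literature.Analysis.FluidPDE.pvAnsatz α (fun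 y _ => U y)) ∧ Literature.Analysis.FluidPDE.HasTypeIDecay C₀ (Literature.Analysis.FluidPDE.pvAnsatz α (fun y _ => U y)) ∧ ∃ P : ℝ → EuclideanSpace ℝ (Fin 3) → ℝ, Literature.Analysis.FluidPDE.IsClassicalNSSolutionOn (Set.Iio 0) 1 0 (Literature.Analysis.FluidPDE.pvAnsatz α (fun y _ => U y)) P := by
  intro C₀ α u p U hsol hI hA
  -- Remark 1.5: the ansatz field is discretely self-similar with some factor `c > 1`
  obtain ⟨c, hc, hφ⟩ := solitonBridge_exists_dss_factor α
  have hdss : IsDiscretelySelfSimilar c (pvAnsatz α (fun y _ => U y)) :=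
    isDiscretelySelfSimilar_pvAnsatz (zero_lt_one.trans hc) hφ U
  -- footnote 13: classical extension to `(−∞, 0)` with one pressure
  obtain ⟨P, hP⟩ := exists_isClassicalNSSolutionOn_Iio_of_rss hsol hc hdss hA
  -- Remark 1.2: the Type-I bound for all `t < 0`
  have hprof : ∀ y : EuclideanSpace ℝ (Fin 3), ‖U y‖ ≤ C₀ / (‖y‖ + 1) :=
    profile_bound_of_typeI hI hA
  have hdec : HasTypeIDecay C₀ (pvAnsatz α (fun y _ => U y)) :=
    fun t ht x => norm_pvAnsatz_le_of_profile hprof ht x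
  have hC₀ : 0 ≤ C₀ := solitonBridge_typeI_const_nonneg hdec
  refine ⟨⟨hP.smooth_velocity, fun t ht => hP.divFree t ht, fun s t hst ht x => ?_,
    HasTypeIDecay.hasTypeITimeDecay hC₀ hdec⟩, hdec, P, hP⟩
  -- KNSS 2009, Thm 6.1: Oseen-mild between all pairs `s < t < 0`
  rw [heatFlow_of_pos _ (sub_pos.2 hst)]
  exact solitonBridge_typeI_mild hP hdec hst ht x

end Summit.NavierStokesRegularity.NavierStokesRegularity.Theorems

end
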